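import Mathlib
import HarnessLib
import Summits.Ventures.LatticeQCDFlow.Exactness.NCMCGeneralSpaceDoeblinPower
import Summits.Ventures.LatticeQCDFlow.Exactness.DoeblinAutocovariance
import Summits.Ventures.LatticeQCDFlow.Scoring.DoeblinSkeleton

/-!
# NCMCGeneralSpaceDoeblinGeometric — a one-step Doeblin constant `ε` BY THE INVARIANT LAW improves
# geometrically under iteration: `(1 − (1 − ε)^{m+1})·π ≤ κ^{m+1}(x, ·)` — the `n_between` lever's
# `ε_m = 1 − (1 − ε)^m`

HONEST FRAMING: exact (Metropolis-corrected) sampling algorithms for lattice gauge theory;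
figures of merit are autocorrelation/cost numbers at stated couplings and volumes; no
continuum-physics claim.

Venture `LatticeQCDFlow` (cell pub-lqcd); FANOUT row 19 (`su2-snf`, GEN-8 §1, split out GEN-9 so that it
does not wait on `Exactness/NCMCGeneralSpaceRestartChainSampleSize`'s olean; the restart-chain corollary
stays in `Exactness/NCMCGeneralSpaceLaunchInterval`).  OUR WORK (a residual-kernel induction; textbook,
no source cited as a fact).  Row 8's `Scoring/DoeblinSkeleton.doeblin_nHit_succ_of_doeblin` records that
a one-step Doeblin constant is an `m`-step constant; when the minorising law is the INVARIANT law `π`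
itself the constant IMPROVES: writing `κ(x, ·) = ε·π + (1 − ε)·R(x, ·)` and using `π κ^m = π`,
`κ^{m+1}(x, B) = ε·π(B) + ∫ κ^{m}(y, B) (κ(x,dy) − ε π(dy)) ≥ ε·π(B) + (1 − ε)(1 − (1 − ε)^m)·π(B)`.
(The Literature's Doeblin convergence `|κᵗ(x, A) − π(A)| ≤ (1 − ε)ᵗ` — Meyn–Tweedie 16.2.4 — gives
only `κᵗ(x, B) ≥ π(B) − (1 − ε)ᵗ`, weaker for small `π(B)`; the multiplicative form is what a
variance-inflation constant needs: `Scaling/LaunchIntervalLaw`'s `C(m) = 1 + 2α·q^m/(1 − q^m)`,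
`q = 1 − ε`, is `Exactness/NCMCGeneralSpaceRestartChainDilution`'s `1 + 2α(1/ε_m − 1)` with
`ε_m = 1 − q^m`.)

* **`doeblin_nHit_geometric`** — `κ` Markov with invariant probability law `π`,
  `ε·π(B) ≤ κ(x, B)` for all `x`, measurable `B`: for every `m`,
  `(1 − (1 − ε)^{m+1})·π(B) ≤ (nHit κ (m+1))(x, B)`;
* `one_div_geometricDoeblin_sub_one` — the dictionary `1/ε_m − 1 = q^m/(1 − q^m)` (`ε_m = 1 − q^m`, reals).
-/

namespace Summit.Ventures.LatticeQCDFlow.Exactness.GeneralNCMC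

open MeasureTheory ProbabilityTheory Set Filter Finset
open scoped ENNReal

/-! ## §1 The geometric improvement of a Doeblin constant by the invariant law -/

section Doeblin

variable {S : Type*} [MeasurableSpace S] {κ : Kernel S S} [IsMarkovKernel κ]
  {π : Measure S} [IsProbabilityMeasure π] {ε : ℝ≥0∞}

/-- **`(1 − (1 − ε)^{m+1})·π ≤ κ^{m+1}(x, ·)`** for a Markov kernel minorised in ONE step by its
invariant probability law, `ε·π(B) ≤ κ(x, B)`. -/
theorem doeblin_nHit_geometric (hπ : Kernel.Invariant κ π)
    (hmin : ∀ x {B : Set S}, MeasurableSet B → ε * π B ≤ κ x B) :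
    ∀ (m : ℕ) (x : S) {B : Set S}, MeasurableSet B →
      (1 - (1 - ε) ^ (m + 1)) * π B ≤ nHit κ (m + 1) x B := by
  have hε1 : ε ≤ 1 := Scoring.eps_le_one_of_doeblin hmin
  intro m
  induction m with
  | zero =>
    intro x B hB
    rw [zero_add, pow_one, nHit_one, ENNReal.sub_sub_cancel ENNReal.one_ne_top hε1]
    exact hmin x hB
  | succ m ih =>
    intro x B hB
    haveI := isMarkovKernel_nHit κ (m + 1)
    -- first-step decomposition: `κ^{m+2} = κ^{m+1} ∘ₖ κ`
    have hdec : nHit κ (m + 1 + 1) x B = ∫⁻ y, nHit κ (m + 1) y B ∂(κ x) := by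
      rw [nHit_add κ (m + 1) 1, nHit_one, Kernel.comp_apply' _ _ _ hB]
    rw [hdec]
    set q : ℝ≥0∞ := (1 - ε) ^ (m + 1) with hq
    set c : ℝ≥0∞ := (1 - q) * π B with hc
    have hq1 : q ≤ 1 := by rw [hq]; exact pow_le_one₀ bot_le tsub_le_self
    have hcfin : c ≠ ∞ := ENNReal.mul_ne_top (ne_top_of_le_ne_top ENNReal.one_ne_top tsub_le_self)
      (measure_ne_top _ _)
    -- the integrand is `≥ c` pointwise (induction hypothesis)
    have hge : ∀ y, c ≤ nHit κ (m + 1) y B := fun y => ih y hB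
    have hfm : Measurable fun y => nHit κ (m + 1) y B := Kernel.measurable_coe _ hB
    -- `∫ f dκx = ∫ (f − c) dκx + c`
    have hsplit : ∫⁻ y, nHit κ (m + 1) y B ∂(κ x)
        = ∫⁻ y, (nHit κ (m + 1) y B - c) ∂(κ x) + c := by
      have : ∀ y, nHit κ (m + 1) y B = (nHit κ (m + 1) y B - c) + c := fun y =>
        (tsub_add_cancel_of_le (hge y)).symm
      conv_lhs => rw [show (fun y => nHit κ (m + 1) y B) = fun y => (nHit κ (m + 1) y B - c) + c
        from funext this]
      rw [lintegral_add_right _ measurable_const, lintegral_const, measure_univ, mul_one]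
    -- `∫ (f − c) dκx ≥ ∫ (f − c) d(ε π) = ε (π B − c)`
    have hle : ε • π ≤ κ x := by
      refine Measure.le_iff.2 fun B' hB' => ?_
      rw [Measure.smul_apply, smul_eq_mul]
      exact hmin x hB'
    have hinv : ∫⁻ y, nHit κ (m + 1) y B ∂π = π B := by
      have h1 := invariant_nHit hπ (m + 1)
      have h2 : (π.bind (nHit κ (m + 1))) B = π B := by rw [h1]
      rwa [Measure.bind_apply hB (Kernel.aemeasurable _)] at h2
    have hlow : ε * (π B - c) ≤ ∫⁻ y, (nHit κ (m + 1) y B - c) ∂(κ x) := by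
      calc ε * (π B - c) = ε * ∫⁻ y, (nHit κ (m + 1) y B - c) ∂π := by
            rw [lintegral_sub' measurable_const.aemeasurable (by
                rw [lintegral_const, measure_univ, mul_one]; exact hcfin)
              (Eventually.of_forall hge), lintegral_const, measure_univ, mul_one, hinv]
        _ = ∫⁻ y, (nHit κ (m + 1) y B - c) ∂(ε • π) := by rw [lintegral_smul_measure, smul_eq_mul]
        _ ≤ ∫⁻ y, (nHit κ (m + 1) y B - c) ∂(κ x) := lintegral_mono' hle le_rfl
    -- assemble: `ε (πB − c) + c = (1 − (1−ε) q) πB`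
    have hcle : c ≤ π B := by
      calc c = (1 - q) * π B := rfl
        _ ≤ 1 * π B := mul_le_mul' tsub_le_self le_rfl
        _ = π B := one_mul _
    calc (1 - (1 - ε) ^ (m + 1 + 1)) * π B = ε * (π B - c) + c := by
          rw [hc, hq, pow_succ]
          -- both sides are finite polynomials in `ε, q, πB`; pass to `ℝ`
          have hεt : ε ≠ ∞ := ne_top_of_le_ne_top ENNReal.one_ne_top hε1
          have hqt : (1 - ε) ^ (m + 1) ≠ ∞ :=
            ENNReal.pow_ne_top (ne_top_of_le_ne_top ENNReal.one_ne_top tsub_le_self)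
          have hπt : π B ≠ ∞ := measure_ne_top _ _
          have h1q : (1 : ℝ≥0∞) - (1 - ε) ^ (m + 1) ≠ ∞ := ne_top_of_le_ne_top ENNReal.one_ne_top tsub_le_self
          rw [← ENNReal.toReal_eq_toReal_iff' (ENNReal.mul_ne_top
              (ne_top_of_le_ne_top ENNReal.one_ne_top tsub_le_self) hπt)
            (ENNReal.add_ne_top.2 ⟨ENNReal.mul_ne_top hεt (ne_top_of_le_ne_top hπt tsub_le_self),
              ENNReal.mul_ne_top h1q hπt⟩)]
          have hsub1 : ((1 : ℝ≥0∞) - (1 - ε) ^ (m + 1) * (1 - ε)).toReal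
              = 1 - ((1 - ε) ^ (m + 1)).toReal * (1 - ε.toReal) := by
            rw [ENNReal.toReal_sub_of_le (by
                calc (1 - ε) ^ (m + 1) * (1 - ε) ≤ 1 * 1 :=
                      mul_le_mul' (pow_le_one₀ bot_le tsub_le_self) tsub_le_self
                  _ = 1 := one_mul 1) ENNReal.one_ne_top,
              ENNReal.toReal_one, ENNReal.toReal_mul, ENNReal.toReal_sub_of_le hε1 ENNReal.one_ne_top,
              ENNReal.toReal_one]
          have hsub2 : ((1 : ℝ≥0∞) - (1 - ε) ^ (m + 1)).toReal = 1 - ((1 - ε) ^ (m + 1)).toReal := by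
            rw [ENNReal.toReal_sub_of_le (pow_le_one₀ bot_le tsub_le_self) ENNReal.one_ne_top,
              ENNReal.toReal_one]
          have hsub3 : (π B - (1 - (1 - ε) ^ (m + 1)) * π B).toReal
              = (π B).toReal - (1 - ((1 - ε) ^ (m + 1)).toReal) * (π B).toReal := by
            rw [ENNReal.toReal_sub_of_le hcle hπt, ENNReal.toReal_mul, hsub2]
          rw [ENNReal.toReal_mul, ENNReal.toReal_add (ENNReal.mul_ne_top hεt
              (ne_top_of_le_ne_top hπt tsub_le_self)) (ENNReal.mul_ne_top h1q hπt),
            ENNReal.toReal_mul, ENNReal.toReal_mul, hsub1, hsub2, hsub3]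
          ring
      _ ≤ ∫⁻ y, (nHit κ (m + 1) y B - c) ∂(κ x) + c := add_le_add hlow le_rfl
      _ = ∫⁻ y, nHit κ (m + 1) y B ∂(κ x) := hsplit.symm

end Doeblin


/-! ## §2 The dictionary with `Scaling/LaunchIntervalLaw` -/

/-- `1/(1 − q^m) − 1 = q^m/(1 − q^m)` (`q^m ≠ 1`): the inflation `1 + 2α(1/ε_m − 1)` of
`Exactness/NCMCGeneralSpaceRestartChainDilution` with `ε_m = 1 − q^m` is `Scaling/LaunchIntervalLaw`'s
`C(m) = 1 + 2α·q^m/(1 − q^m)`. -/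
theorem one_div_geometricDoeblin_sub_one {q : ℝ} {m : ℕ} (h : q ^ m ≠ 1) :
    1 / (1 - q ^ m) - 1 = q ^ m / (1 - q ^ m) := by
  have h' : 1 - q ^ m ≠ 0 := sub_ne_zero.2 (Ne.symm h)
  field_simp
  ring

end Summit.Ventures.LatticeQCDFlow.Exactness.GeneralNCMC
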